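import Summits.QuantumFields.YangMills.Theorems.BalabanUVNodesN19SourceSplit
import Summits.QuantumFields.YangMills.Theorems.BalabanUVNodesN19LedgerPiecesRoadII
import Summits.QuantumFields.BalabanUV.T4Continuum.Spine.NE1p.DressedMGFForm

/-!
# BalabanUVNodes ∕ N19 (NE7 proper) — THE VACUUM LEDGER MEETS THE MGF ROAD AT `S_N19` (lens «decomp» v4, ROW VL): the «(V)+(I) producer»
# DECOMPOSED BY NAME — (I) is N14's `TiltedMeanMatching`, (V) is the N19 ledger of record on the VACUUM cores; N19 owns the JOIN, no estimate

Cell `pub-ymgap` (HUMAN RULING D-0062, Track A), R134 ACCELERATION seat `pub-ymgap-dag-n19-d` (strategy s2 «by-name knit at the record»), gen 5, module 14 =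
FAN-OUT v4 ROW VL of the lens seat `ym-lens-BalabanUVNodes-decomp` (memo `run/shared/lean/pub/pub-ymgap/ym-lens-BalabanUVNodes-decomp/LENS-decomp.md` v4
sha16 f0080832305225a7 §v4.4, bus line 2026-08-27T00:48:47Z: «ROW VL → n19-d g5 NOW … typable NOW, S-sized, THEOREMS ONLY»).  AUTHORSHIP: §1–§4 below are the
lens seat's sketch `…/ym-lens-BalabanUVNodes-decomp/lean/LensDecompNE7v4.sketch.lean` (sha16 b90d49dc05091502, planner-ym-lens-BalabanUVNodes-decomp-g4-0,
farm rc 0 ∕ 0 sorry ∕ 0 warning 00:31Z; not filed there — memo lane) §1–§4 LIFTED TOKEN FOR TOKEN into the Theorems namespace (statements and proofs; the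
sketch's §5 «VL-5 ∕ K5» is NOT lifted — row VL-K5, assigned to dag-n19-c g5 by dag-lead DEDUP-230, bus 2026-08-27T01:00:34Z); §5 below is NEW here (the junction with this seat's `N19LedgerPiecesRoadII`,
p478820 — the row's «OPTIONAL 10th»).  Filed `--kind proof --supports` K3′ `SpineGivenEndpointR12` = stmt-QuantumFields-19908 `--as helper`.  COUNT-NEUTRAL.
THEOREMS ONLY; no Theses import; edits nothing.

WHY (this seat's g4 HANDOFF, bus l.14410: «what N19's discharge still hinges on: (i) a PRODUCER of the same-tuple all-run-lengths edge — equivalently a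
(V)+(I) SOURCE-SPLIT READING … NOT PRINTED»).  The lens seat's v4 finding: that producer DECOMPOSES BY NAME and neither half is N19's —
* (I) = node N14's residual binder `DressedMGFForm.TiltedMeanMatching l₀ T Bad Fo ν Fo′ ν′ η` TOKEN FOR TOKEN: under an MGF form of the shell-free class
  terms (`DressedMGFForm.MGFForm`: `P K t τ = ∫ e^{t·Fo K} dν K τ`) dag-n19-e's source-split derivative letters `mP ∕ mQ` (`N19SourceSplit.core_of_vacuum_of_insertionDeriv`)
  ARE the tilted means (`s ↦ log P K s τ` is Mathlib's `cgf`, `deriv_cgf_eq_tiltedMean`), and `|mQ − mP| ≤ Λ` IS `TiltedMeanMatching` with `Λ = η` (§2);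
* (V) = the N19 ledger of record INSTANCED ON THE VACUUM CORES `(K, t, τ) ↦ P K 0 τ`, `Q K 0 τ`: `N19LedgerLinkSync.core_summable_of_ledgerAtSync` and this
  seat's `N19LedgerPiecesRoadII.core_summable_of_ledgerPieces_species` are `(A, B)`-generic, so at `t = 0` they give exactly the `h0` of
  `DressedMGFForm.core_of_mgfForm` (§3, §5);
* the JOIN is N19's and typed: `core_of_coreZero_mgfForm` (dressed `NE7.Core` with remainder `δ⁰ + (l₀∕vol)·η`, same `c_K`, no positivity) and the readings
  `s_N19_of_vacuumCoreMGFReading` (§4) ∕ `s_N19_of_vacuumLedgerPiecesMGFReading` (§5) under the `deltaOfRecord` pin of record.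
CONSEQUENCES recorded by the lens (memo §v4.1–§v4.3): on the vacuum instance the observable NEVER ENTERS N19's ledger — every `t`-slot of `LedgerDataSync`
idle, no observable kind, species (β) does not occur (row s4″-β VOID), the size binder is the UNDRESSED (2.43)∕(2.45) (N11 alone), the in-edge N14 → N19
meets K5 only at the MGF join; v3's booking B2 is RETIRED.  N19's own content on this road = the vacuum ledger's bookings (F1 representation on a common
`μ₀`, B1, B3) — NO ESTIMATE.

CONTENTS.
* §1 VL-0 ∕ VL-1 (lifted): `coreZero_of_coreAtZero` · `core_of_coreZero_mgfForm` · `coreEdge_of_coreZero_mgfForm`.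
* §2 VL-4 (lifted): `log_eq_cgf_of_mgfForm` · `hasDerivWithinAt_log_of_mgfForm` · `insertionDerivHyps_of_mgfForm` · `core_of_vacuum_of_mgfForm_tiltedMeanMatching`
  — dag-n19-e's road (p468320) FED BY N14's binder: the source-split road and the MGF road are ONE road.
* §3 VL-3 (lifted): `coreEdge_of_vacuumLedgerAtSync_mgfForm` — road (ii) at N19 in one theorem from `LedgerAtSync` on the vacuum cores.
* §4 VL-2 (lifted): `s_N19_of_vacuumCoreMGFReading` — the `S_N19` reading on this road.
* §5 NEW (ROW VL's optional 10th, this seat): `coreEdge_of_vacuumLedgerPiecesSpecies_mgfForm` · `s_N19_of_vacuumLedgerPiecesMGFReading` — §3∕§4 with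
  `LedgerAtSync` REPLACED by the five object-bound ∕ printed-grade pieces F1 · F2 · F3 · S · C of `N19LedgerPieces` (p475201) and the SPECIES DATA in place of
  F3′ (`N19LedgerPiecesRoadII.core_summable_of_ledgerPieces_species`, p478820 ∘ dag-n19-c's `N19FinestStepSpecies`, p477972): THE road-(ii) ask of a spine
  record with NO observable and NO unprinted estimate inside N19.

HONEST FRAMING.  Kernel bookkeeping over hypothesis SHAPES already in the tree, cited BY NAME; the vacuum instance is a CHOICE OF INSTANCE for NODE O argued
cheaper by the lens, not a construction; `TiltedMeanMatching` (N14's NE1′ residual, [Balaban1989LargeFieldII] p. 356), the vacuum `Core`, the MGF forms, every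
ledger piece ∕ species datum ∕ in-edge letter are HYPOTHESES; nothing of Bałaban's is instantiated or asserted beyond the locators quoted; NE7 ∕ NE3 ∕ NE1′ ∕
[III] Thm 2 (2.43) ∕ β-matching NOT PRINTED as two-run statements for d = 4 and NOT proved; NO node is discharged; K3′ NOT claimed; counts UNMOVED (typed 28∕28 ·
discharged 5∕27, A 5∕28); one finite four-torus programme at fixed `ε = L^{−K}` — NOT ℝ⁴, NOT infinite volume, NOT OS, NOT a mass gap, NOT Clay.  0 `def`;
0 `sorry`; standard axioms; no decl below carries a cite tag.
-/

set_option autoImplicit false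

noncomputable section

open Finset MeasureTheory ProbabilityTheory
open scoped BigOperators

namespace Summit.QuantumFields.YangMills.BalabanUVNodes.N19VacuumMGFRoad

open Literature.MathematicalPhysics.QuantumFieldTheory.Balaban1983to89
open T4OutputRate T4RecentScale T4GoodClassBudget T4CauchySum T4TowerRateComposition T4TowerRateDischarge
open T4EtaRateMin (Readings NE3Shape)
open T4RateLiaison (GaugeDominated)
open Summit.QuantumFields.BalabanUV.T4Continuum.Spine
open Summit.QuantumFields.BalabanUV.T4Continuum.NE1p.DressedMGFForm
open Summit.QuantumFields.YangMills.BalabanUVNodes.N19AtSpineCarriers (deltaOfRecord s_N19_of_coreEdge)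
open Summit.QuantumFields.YangMills.BalabanUVNodes.N19LedgerLinkSync (LedgerDataSync LedgerAtSync core_summable_of_ledgerAtSync)
open Summit.QuantumFields.YangMills.BalabanUVNodes.N19LedgerPieces (TwoRunFormat LedgerBooking LedgerOtherKinds LedgerSize LedgerConventions)
open Summit.QuantumFields.YangMills.BalabanUVNodes.N19LedgerPiecesRoadII (core_summable_of_ledgerPieces_species)
open Summit.QuantumFields.YangMills.BalabanUVNodes.N19SourceSplit (uIcc_subset_Icc_of_abs_le core_of_vacuum_of_insertionDeriv)
open YMDAG.UVSplit (SpineCarriers SpineRecordPred InputsPred S_N19)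

/-! ## §1 VL-0 ∕ VL-1 — the `Core`-level join: dressed `Core` ⇐ vacuum `Core` + MGF forms + `TiltedMeanMatching` (lens sketch §1, lifted) -/

section Join

variable {ι : Type*} [DecidableEq ι] {Ω Ω' : ℕ → Type*} [∀ K, MeasurableSpace (Ω K)] [∀ K, MeasurableSpace (Ω' K)]
  {Bo l₀ vol : ℝ} {T : ℕ → Finset ι} {Bad : ℕ → ℝ → Finset ι} {Fo : ∀ K, Ω K → ℝ} {ν : ∀ K, ι → Measure (Ω K)}
  {Fo' : ∀ K, Ω' K → ℝ} {ν' : ∀ K, ι → Measure (Ω' K)} {P Q : ℕ → ℝ → ι → ℝ} {δ₀ η : ℕ → ℝ}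

/-- **VL-0 (which classes the vacuum sandwich must cover)** [bookkeeping].  `core_of_mgfForm` asks the `t = 0` sandwich on every class
good at SOME admissible source `t`; if the bad classes only grow with the source (`Bad K 0 ⊆ Bad K t`, n19-e's `hBad`), the sandwich on the
classes good AT `t = 0` suffices — the vacuum ledger is indexed by `T K ∖ Bad K 0`. [folklore] -/
theorem coreZero_of_coreAtZero (hBad : ∀ K (t : ℝ), |t| ≤ l₀ → Bad K 0 ⊆ Bad K t)
    (h : ∀ K, ∃ c : ℝ, ∀ τ ∈ T K \ Bad K 0,
      Real.exp (c - vol * δ₀ K) * P K 0 τ ≤ Q K 0 τ ∧ Q K 0 τ ≤ Real.exp (c + vol * δ₀ K) * P K 0 τ) :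
    NE7.Core l₀ vol T Bad (fun K _ τ => P K 0 τ) (fun K _ τ => Q K 0 τ) δ₀ := by
  intro K
  obtain ⟨c, hc⟩ := h K
  refine ⟨c, fun t ht τ hτ => hc τ ?_⟩
  rw [Finset.mem_sdiff] at hτ ⊢
  exact ⟨hτ.1, fun h0 => hτ.2 (hBad K t ht h0)⟩

/-- **VL-1 — THE JOIN AT N19's LEAF SHAPE** [bookkeeping].  Shell-free cores `P` (run A) and `Q` (run B) in MGF form (`DressedMGFForm.MGFForm`:
`P K t τ = ∫ e^{t·Fo K} dν K τ`), the VACUUM cores `t ↦ P K 0 τ`, `t ↦ Q K 0 τ` carrying `NE7.Core … δ⁰` (= what the N19 ledger road produces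
when its ledger is the vacuum ledger), and N14's residual binder `TiltedMeanMatching l₀ T Bad Fo ν Fo′ ν′ η` ⇒ the DRESSED cores carry
`NE7.Core … (δ⁰ + (l₀∕vol)·η)` with the SAME constants `c_K` — `DressedMGFForm.core_of_mgfForm` BY NAME (its `h0` is literally
`NE7.Core` of the t-idle families with `w K = vol·δ⁰_K`).  No positivity hypothesis (massless classes handled inside). [folklore] -/
theorem core_of_coreZero_mgfForm (hvol : 0 < vol) (hP : MGFForm Bo T Fo ν P) (hQ : MGFForm Bo T Fo' ν' Q)
    (h0 : NE7.Core l₀ vol T Bad (fun K _ τ => P K 0 τ) (fun K _ τ => Q K 0 τ) δ₀)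
    (hη : TiltedMeanMatching l₀ T Bad Fo ν Fo' ν' η) :
    NE7.Core l₀ vol T Bad P Q (fun K => δ₀ K + l₀ / vol * η K) :=
  core_of_mgfForm (w := fun K => vol * δ₀ K) hP hQ h0 hη fun K => by
    show vol * δ₀ K + l₀ * η K ≤ vol * (δ₀ K + l₀ / vol * η K)
    rw [mul_add, ← mul_assoc, mul_div_cancel₀ l₀ hvol.ne']

/-- **VL-1′ — the ∃δ-edge** (the shape every landed N19 knit concludes, `N19AtSpineCarriers.s_N19_of_coreEdge`'s hypothesis): vacuum `Core`
with `Summable δ⁰` + MGF forms + `TiltedMeanMatching η` with `Summable η` ⇒ `∃ δ, NE7.Core l₀ vol T Bad P Q δ ∧ Summable δ`. [folklore] -/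
theorem coreEdge_of_coreZero_mgfForm (hvol : 0 < vol) (hP : MGFForm Bo T Fo ν P) (hQ : MGFForm Bo T Fo' ν' Q)
    (h0 : NE7.Core l₀ vol T Bad (fun K _ τ => P K 0 τ) (fun K _ τ => Q K 0 τ) δ₀) (hδ₀ : Summable δ₀)
    (hη : TiltedMeanMatching l₀ T Bad Fo ν Fo' ν' η) (hηs : Summable η) :
    ∃ δ : ℕ → ℝ, NE7.Core l₀ vol T Bad P Q δ ∧ Summable δ :=
  ⟨_, core_of_coreZero_mgfForm hvol hP hQ h0 hη, hδ₀.add (hηs.mul_left (l₀ / vol))⟩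

/-! ## §2 VL-4 — n19-e's producer face `core_of_vacuum_of_insertionDeriv` IS FED BY N14's binder (the two (I)-faces coincide; lens sketch §2, lifted) -/

omit [DecidableEq ι] in
/-- Under an MGF form the log-core IS Mathlib's cumulant generating function of the class: `log P_K(·,τ) = cgf (Fo K) (ν K τ)`. [folklore] -/
theorem log_eq_cgf_of_mgfForm (hP : MGFForm Bo T Fo ν P) (K : ℕ) {τ : ι} (hτ : τ ∈ T K) :
    (fun s => Real.log (P K s τ)) = cgf (Fo K) (ν K τ) :=
  funext fun s => by rw [hP.repr K s τ hτ]; rfl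

omit [DecidableEq ι] in
/-- … hence it is differentiable in the source with derivative the TILTED MEAN (`DressedMGFForm.deriv_cgf_eq_tiltedMean` +
`T4GenFunBounds.differentiable_cgf_of_abs_le`): n19-e's derivative letter `mP K s τ` is `tiltedMean (Fo K) (ν K τ) s`. [folklore] -/
theorem hasDerivWithinAt_log_of_mgfForm (hP : MGFForm Bo T Fo ν P) (K : ℕ) {τ : ι} (hτ : τ ∈ T K) (S : Set ℝ) (s : ℝ) :
    HasDerivWithinAt (fun s => Real.log (P K s τ)) (tiltedMean (Fo K) (ν K τ) s) S s := by
  haveI := hP.finite K τ hτ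
  rw [log_eq_cgf_of_mgfForm hP K hτ, ← deriv_cgf_eq_tiltedMean (hP.meas K) (hP.bound K) s]
  exact ((T4GenFunBounds.differentiable_cgf_of_abs_le (μ := ν K τ) (hP.meas K).aemeasurable
    (ae_of_all _ (hP.bound K))) s).hasDerivAt.hasDerivWithinAt

/-- **THE THREE (I)-HYPOTHESES OF `N19SourceSplit.core_of_vacuum_of_insertionDeriv` FROM MGF FORMS + `TiltedMeanMatching`** [bookkeeping]:
`hdP`, `hdQ` with `mP = tiltedMean (Fo K) (ν K τ)`, `mQ = tiltedMean (Fo′ K) (ν′ K τ)`, and `hm` with `Λ = η` (a tilt on the source segment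
`[0, t]` of an admissible `t` is admissible: n19-e's `uIcc_subset_Icc_of_abs_le`). [folklore] -/
theorem insertionDerivHyps_of_mgfForm (hP : MGFForm Bo T Fo ν P) (hQ : MGFForm Bo T Fo' ν' Q)
    (hη : TiltedMeanMatching l₀ T Bad Fo ν Fo' ν' η) :
    (∀ K, ∀ τ ∈ T K, ∀ s ∈ Set.Icc (-l₀) l₀,
      HasDerivWithinAt (fun s => Real.log (P K s τ)) (tiltedMean (Fo K) (ν K τ) s) (Set.Icc (-l₀) l₀) s) ∧
    (∀ K, ∀ τ ∈ T K, ∀ s ∈ Set.Icc (-l₀) l₀,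
      HasDerivWithinAt (fun s => Real.log (Q K s τ)) (tiltedMean (Fo' K) (ν' K τ) s) (Set.Icc (-l₀) l₀) s) ∧
    (∀ K (t : ℝ), |t| ≤ l₀ → ∀ τ ∈ T K \ Bad K t, ∀ s ∈ Set.uIcc (0 : ℝ) t,
      |tiltedMean (Fo' K) (ν' K τ) s - tiltedMean (Fo K) (ν K τ) s| ≤ η K) :=
  ⟨fun K τ hτ s _ => hasDerivWithinAt_log_of_mgfForm hP K hτ _ s,
   fun K τ hτ s _ => hasDerivWithinAt_log_of_mgfForm hQ K hτ _ s,
   fun K t ht τ hτ s hs => by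
     have hs' := uIcc_subset_Icc_of_abs_le ht hs
     exact hη K t ht τ hτ s (abs_le.mpr ⟨hs'.1, hs'.2⟩)⟩

/-- **VL-4 — n19-e's ROAD FED BY N14's BINDER** [bookkeeping]: (V) in n19-e's log form with `δ⁰`, positive cores on the good classes, MGF
forms and `TiltedMeanMatching η` (`0 ≤ η`) ⇒ `NE7.Core … (δ⁰_K + η_K·l₀∕vol)` — `core_of_vacuum_of_insertionDeriv` ∘ `insertionDerivHyps_of_mgfForm`.
Same remainder as VL-1 (which needs no positivity): the source-split road and the MGF road are ONE road. [folklore] -/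
theorem core_of_vacuum_of_mgfForm_tiltedMeanMatching (hvol : 0 < vol) (hη0 : ∀ K, 0 ≤ η K)
    (hPpos : ∀ K t, |t| ≤ l₀ → ∀ τ ∈ T K \ Bad K t, 0 < P K t τ)
    (hQpos : ∀ K t, |t| ≤ l₀ → ∀ τ ∈ T K \ Bad K t, 0 < Q K t τ)
    (hV : ∀ K, ∃ c : ℝ, ∀ t : ℝ, |t| ≤ l₀ → ∀ τ ∈ T K \ Bad K t,
      |Real.log (Q K 0 τ) - Real.log (P K 0 τ) - c| ≤ vol * δ₀ K)
    (hP : MGFForm Bo T Fo ν P) (hQ : MGFForm Bo T Fo' ν' Q) (hη : TiltedMeanMatching l₀ T Bad Fo ν Fo' ν' η) :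
    NE7.Core l₀ vol T Bad P Q (fun K => δ₀ K + η K * l₀ / vol) := by
  obtain ⟨hdP, hdQ, hm⟩ := insertionDerivHyps_of_mgfForm (l₀ := l₀) (Bad := Bad) hP hQ hη
  exact core_of_vacuum_of_insertionDeriv hvol hη0 hPpos hQpos hV hdP hdQ hm

end Join

/-! ## §3 VL-3 — the N19 ∃δ-edge for the DRESSED cores from the VACUUM ledger of record + the in-edges + MGF forms + N14's binder (lens sketch §3, lifted) -/

section Ledger

variable {C : Carriers} [DecidableEq C.Dom] {F : Type*} {ι' X : Type} [MeasurableSpace ι'] {σ : Type*} [DecidableEq σ]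
  {L : LedgerDataSync C F ι' σ} {l₀ vol : ℝ} {T : ℕ → Finset σ} {Bad : ℕ → ℝ → Finset σ}
  {R : Readings ι' X} {W : Set (ℕ → ℝ)} {EA : Functional C C.BgA} {EB : Functional C C.BgB}
  {κ θ₅ C₅ C₉ ω θc Cd γ C₃ θ₃ Pg : ℝ} {q : ℕ} {Λm : ℕ → ℕ → ℝ} {CU : (ℕ → ℝ) → ℕ → ℝ}
  {g : ℕ → ℕ → ℝ} {uA : ℕ → ι' → C.BgA} {uB : ℕ → ι' → C.BgB}
  {Ω Ω' : ℕ → Type*} [∀ K, MeasurableSpace (Ω K)] [∀ K, MeasurableSpace (Ω' K)] {Bo : ℝ}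
  {Fo : ∀ K, Ω K → ℝ} {ν : ∀ K, σ → Measure (Ω K)} {Fo' : ∀ K, Ω' K → ℝ} {ν' : ∀ K, σ → Measure (Ω' K)}
  {P Q : ℕ → ℝ → σ → ℝ} {η : ℕ → ℝ}

/-- **VL-3 — ROAD (ii) AT N19, IN ONE THEOREM** [bookkeeping].  The synchronised ledger predicate of record `LedgerAtSync` (n19-b∕n19-d;
cell NODE O instances it) ON THE VACUUM CORES `(K, t, τ) ↦ P K 0 τ`, `Q K 0 τ` — every `t`-slot of the ledger data idle, NO observable
kind among the other kinds, the (2.43) size binder UNDRESSED (N11 alone) —, the in-edges BY NAME exactly as in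
`N19LedgerLinkSync.core_summable_of_ledgerAtSync` (N16 `NE3Shape` + `GaugeDominated`, N18 `NE5`, N22 `NE9 ∧ FadingMemory`, N17 via U2's
`InjectedRate`, bracket (T) `LipBackground` + `PolyLipGrowth`, couplings in the window), MGF forms of the dressed shell-free cores, and N14's
`TiltedMeanMatching η` with `Summable η` (producer of record: `N14TiltedMatching.tiltedMeanMatching_summable_of_n14` ∕
`N14YoungRateC1.tiltedMeanMatching_summable_of_ratesAt_byNameC1`) ⇒ `∃ δ, NE7.Core l₀ vol T Bad P Q δ ∧ Summable δ` for the DRESSED cores.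
The observable meets N19 ONLY through `η`. CONDITIONAL on every binder; NOT NE7. [folklore] -/
theorem coreEdge_of_vacuumLedgerAtSync_mgfForm
    (hL : LedgerAtSync L l₀ vol T Bad (fun K _ τ => P K 0 τ) (fun K _ τ => Q K 0 τ) R EA EB κ g uA uB ω θc θ₅ θ₃)
    (h16 : NE3Shape R C₃ θ₃) (hC₃ : 0 ≤ C₃) (hgd : GaugeDominated R uA uB)
    (h18 : NE5 EA EB W κ θ₅ C₅) (hθ₅ : 0 ≤ θ₅) (hC₅ : 0 ≤ C₅)
    (h22 : NE9 EA W κ Λm ∧ T4OutputRate.FadingMemory C₉ ω Λm) (hω : 0 ≤ ω)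
    (hinj : InjectedRate Cd 0 θc (fun K j => T4CouplingMatching.disc (g K) (g (K + 1)) j)) (hCd : 0 ≤ Cd)
    (hθc : 0 ≤ θc) (hbox : ∀ K i, i ≤ K → 0 < g K i ∧ g K i ≤ γ)
    (hU : LipBackground EA W κ CU) (hG : PolyLipGrowth CU g Pg q) (hPg : 0 ≤ Pg)
    (hgA : ∀ K, g K ∈ W) (hgB : ∀ K, (fun i => g (K + 1) (i + 1)) ∈ W)
    (hvol : 0 < vol) (hP : MGFForm Bo T Fo ν P) (hQ : MGFForm Bo T Fo' ν' Q)
    (hη : TiltedMeanMatching l₀ T Bad Fo ν Fo' ν' η) (hηs : Summable η) :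
    ∃ δ : ℕ → ℝ, NE7.Core l₀ vol T Bad P Q δ ∧ Summable δ := by
  obtain ⟨δ₀, h0, hδ₀⟩ :=
    core_summable_of_ledgerAtSync hL h16 hC₃ hgd h18 hθ₅ hC₅ h22 hω hinj hCd hθc hbox hU hG hPg hgA hgB
  exact coreEdge_of_coreZero_mgfForm hvol hP hQ h0 hδ₀ hη hηs

end Ledger

/-! ## §4 VL-2 — the `S_N19` READING on road (ii), under the pin of record (lens sketch §4, lifted) -/

section Reading

variable {N : ℕ} [NeZero N]

/-- **VL-2 — `S_N19` FROM A VACUUM-CORE + MGF + TILTED-MATCHING READING** [bookkeeping] (pin of record as in every landed N19 reading).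
If the carriers of record and K4's inputs hand, for every bundle: `0 < S.vol`; the VACUUM shell-free cores' `NE7.Core` with a summable `δ⁰`
(road: VL-3's ledger half, or any N19 knit of record applied to the t-idle cores); MGF forms of BOTH dressed shell-free cores over SOME
field spaces, ONE bounded observable per run and class measures (N27x∕NODE 00's `mgfForm_of_density` ∕ `.sub`); and N14's
`TiltedMeanMatching` on those measures with a summable `η` — then `YMDAG.UVSplit.S_N19 SRec Inputs`.  The ∃-package is what `SRec ∧ Inputs`
must jointly supply on road (ii); N19's own content in it is NIL beyond the vacuum ledger's bookings. NOT NE7. [folklore] -/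
theorem s_N19_of_vacuumCoreMGFReading (SRec : SpineRecordPred N) (Inputs : InputsPred N)
    (hpin : ∀ (F : T4Continuum.T4Family) (D : YMDAG.UVSplit.Datum F N) (g₀ : ℕ → ℝ) (os : List (T4Continuum.ULoop F))
      (S : SpineCarriers), SRec F D g₀ os S → letI := S.dec
      S.δ = deltaOfRecord S.l₀ S.vol S.T S.Bad (fun K t τ => S.A K t τ - S.shA K t τ) (fun K t τ => S.B K t τ - S.shB K t τ))
    (hread : ∀ (F : T4Continuum.T4Family) (D : YMDAG.UVSplit.Datum F N) (g₀ : ℕ → ℝ) (os : List (T4Continuum.ULoop F))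
      (S : SpineCarriers), SRec F D g₀ os S → Inputs F D g₀ os → letI := S.dec
      0 < S.vol ∧
      ∃ (δ₀ η : ℕ → ℝ) (Ω Ω' : ℕ → Type) (_ : ∀ K, MeasurableSpace (Ω K)) (_ : ∀ K, MeasurableSpace (Ω' K)) (Bo : ℝ)
        (Fo : ∀ K, Ω K → ℝ) (ν : ∀ K, S.ι → Measure (Ω K)) (Fo' : ∀ K, Ω' K → ℝ) (ν' : ∀ K, S.ι → Measure (Ω' K)),
        NE7.Core S.l₀ S.vol S.T S.Bad (fun K _ τ => S.A K 0 τ - S.shA K 0 τ) (fun K _ τ => S.B K 0 τ - S.shB K 0 τ) δ₀ ∧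
        Summable δ₀ ∧
        MGFForm Bo S.T Fo ν (fun K t τ => S.A K t τ - S.shA K t τ) ∧
        MGFForm Bo S.T Fo' ν' (fun K t τ => S.B K t τ - S.shB K t τ) ∧
        TiltedMeanMatching S.l₀ S.T S.Bad Fo ν Fo' ν' η ∧ Summable η) :
    S_N19 SRec Inputs := by
  refine s_N19_of_coreEdge SRec Inputs hpin fun F D g₀ os S hS hI => ?_
  letI := S.dec
  obtain ⟨hvol, δ₀, η, Ω, Ω', _, _, Bo, Fo, ν, Fo', ν', h0, hδ₀, hP, hQ, hη, hηs⟩ := hread F D g₀ os S hS hI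
  exact coreEdge_of_coreZero_mgfForm hvol hP hQ h0 hδ₀ hη hηs

end Reading

/-! ## §5 NEW (ROW VL's optional 10th) — §3∕§4 at the PIECES of record with the SPECIES DATA in place of F3′: no observable AND no unprinted estimate inside N19 -/

section LedgerPieces

variable {C : Carriers} [DecidableEq C.Dom] {F : Type*} {ι' X : Type} [MeasurableSpace ι'] {σ : Type*} [DecidableEq σ]
  {L : LedgerDataSync C F ι' σ} {l₀ vol : ℝ} {T : ℕ → Finset σ} {Bad : ℕ → ℝ → Finset σ}
  {R : Readings ι' X} {W : Set (ℕ → ℝ)} {EA : Functional C C.BgA} {EB : Functional C C.BgB}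
  {κ θ₅ C₅ C₉ ω θc Cd γ C₃ θ₃ Pg : ℝ} {q : ℕ} {Λm : ℕ → ℕ → ℝ} {CU : (ℕ → ℝ) → ℕ → ℝ}
  {g : ℕ → ℕ → ℝ} {uA : ℕ → ι' → C.BgA} {uB : ℕ → ι' → C.BgB}
  {Φ : ℕ → ℝ → σ → ι' → ℝ} {e ρ : ℕ → ℝ} {α β : ℕ → ℝ → σ → ℝ}
  {Ω Ω' : ℕ → Type*} [∀ K, MeasurableSpace (Ω K)] [∀ K, MeasurableSpace (Ω' K)] {Bo : ℝ}
  {Fo : ∀ K, Ω K → ℝ} {ν : ∀ K, σ → Measure (Ω K)} {Fo' : ∀ K, Ω' K → ℝ} {ν' : ∀ K, σ → Measure (Ω' K)}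
  {P Q : ℕ → ℝ → σ → ℝ} {η : ℕ → ℝ}

/-- **ROAD (ii) AT N19 FROM THE LEDGER PIECES ON THE VACUUM CORES, F3′ SUPPLIED BY THE SPECIES DATA** [bookkeeping] — §3's
`coreEdge_of_vacuumLedgerAtSync_mgfForm` with `LedgerAtSync` REPLACED by F1 `TwoRunFormat` · F2 `LedgerBooking` · F3 `LedgerOtherKinds` · S `LedgerSize` ·
C `LedgerConventions` ON THE VACUUM CORES `(K, t, τ) ↦ P K 0 τ`, `Q K 0 τ` and the SPECIES DATA of the remaining kinds (`L.oA″ = exp α`,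
`L.oB″ = exp(Φ + e)·exp β`, `L.cO″ = e + (β − α)`, `L.RO″ = vol·ρ`, `L.rO″ = ρ`; the ONE-RUN first-step bound `|Φ| ≤ vol·ρ K` on good classes, `Summable ρ` —
UNDRESSED (2.43)∕(2.45) at age `K+1`, N11 by name; the constants' deviation datum `(b₀, s)`) — `N19LedgerPiecesRoadII.core_summable_of_ledgerPieces_species`
(p478820) at the t-idle cores —, plus the in-edge letters, MGF forms of the dressed shell-free cores and N14's `TiltedMeanMatching η` with `Summable η`
⇒ `∃ δ, NE7.Core l₀ vol T Bad P Q δ ∧ Summable δ` for the DRESSED cores.  No observable kind, no species (β), no F3′ hypothesis.  CONDITIONAL on every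
binder; NOT NE7. -/
theorem coreEdge_of_vacuumLedgerPiecesSpecies_mgfForm
    (hF : TwoRunFormat L l₀ T Bad (fun K _ τ => P K 0 τ) (fun K _ τ => Q K 0 τ) R EA EB g uA uB) (hB : LedgerBooking L l₀ vol T Bad κ)
    (hO : LedgerOtherKinds L l₀ vol T Bad R EA EB g) (hS : LedgerSize L l₀ vol T Bad R EA EB g uA uB) (hC : LedgerConventions L vol R ω θc θ₅ θ₃)
    (hoA : ∀ K t τ v, L.oA'' K t τ v = Real.exp (α K t τ))
    (hoB : ∀ K t τ v, L.oB'' K t τ v = Real.exp (Φ K t τ v + e K) * Real.exp (β K t τ))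
    (hcO : ∀ K t τ, L.cO'' K t τ = e K + (β K t τ - α K t τ)) (hRO : ∀ K t τ, L.RO'' K t τ = vol * ρ K) (hrO : L.rO'' = ρ)
    (hΦ : ∀ K t, |t| ≤ l₀ → ∀ τ ∈ T K \ Bad K t, ∀ v ∈ R.dom, |Φ K t τ v| ≤ vol * ρ K) (hρ : Summable ρ)
    (hdev : ∃ b₀ s : ℕ → ℝ, Summable s ∧ ∀ K t, |t| ≤ l₀ → ∀ τ ∈ T K \ Bad K t, |β K t τ - α K t τ - b₀ K| ≤ vol * s K)
    (h16 : NE3Shape R C₃ θ₃) (hC₃ : 0 ≤ C₃) (hgd : GaugeDominated R uA uB)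
    (h18 : NE5 EA EB W κ θ₅ C₅) (hθ₅ : 0 ≤ θ₅) (hC₅ : 0 ≤ C₅)
    (h22 : NE9 EA W κ Λm ∧ T4OutputRate.FadingMemory C₉ ω Λm) (hω : 0 ≤ ω)
    (hinj : InjectedRate Cd 0 θc (fun K j => T4CouplingMatching.disc (g K) (g (K + 1)) j)) (hCd : 0 ≤ Cd)
    (hθc : 0 ≤ θc) (hbox : ∀ K i, i ≤ K → 0 < g K i ∧ g K i ≤ γ)
    (hU : LipBackground EA W κ CU) (hG : PolyLipGrowth CU g Pg q) (hPg : 0 ≤ Pg)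
    (hgA : ∀ K, g K ∈ W) (hgB : ∀ K, (fun i => g (K + 1) (i + 1)) ∈ W)
    (hvol : 0 < vol) (hP : MGFForm Bo T Fo ν P) (hQ : MGFForm Bo T Fo' ν' Q)
    (hη : TiltedMeanMatching l₀ T Bad Fo ν Fo' ν' η) (hηs : Summable η) :
    ∃ δ : ℕ → ℝ, NE7.Core l₀ vol T Bad P Q δ ∧ Summable δ := by
  obtain ⟨δ₀, h0, hδ₀⟩ := core_summable_of_ledgerPieces_species hF hB hO hS hC hoA hoB hcO hRO hrO hΦ hρ hdev h16 hC₃ hgd h18 hθ₅ hC₅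
    h22 hω hinj hCd hθc hbox hU hG hPg hgA hgB
  exact coreEdge_of_coreZero_mgfForm hvol hP hQ h0 hδ₀ hη hηs

end LedgerPieces

section LedgerPiecesReading

variable {N : ℕ} [NeZero N]

/-- **`S_N19` FROM A VACUUM-LEDGER-PIECES + SPECIES + MGF + TILTED-MATCHING READING** [bookkeeping] (ROW VL's optional 10th: THE road-(ii) ask of a spine
record with NO observable and NO unprinted estimate inside N19; pin of record).  Per bundle the carriers of record and K4's inputs hand: `0 < S.vol`; ledger
data `L`, readings `R` and letters with F1 · F2 · F3 · S · C ON THE VACUUM shell-free cores `(K, t, τ) ↦ S.A K 0 τ − S.shA K 0 τ`, `S.B K 0 τ − S.shB K 0 τ`;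
the remaining kinds in SPECIES FORM with the ONE-RUN first-step bound (`|Φ| ≤ S.vol·ρ K`, `Summable ρ`) and a constants' deviation datum; the in-edge letters
(N16 ∕ N17 via U2 ∕ N18 ∕ N22, the box, the bracket (T), the window); MGF forms of BOTH dressed shell-free cores over some field spaces with class measures;
and N14's `TiltedMeanMatching` on those measures with a summable `η` ⇒ `YMDAG.UVSplit.S_N19 SRec Inputs`.  `SRec`, `Inputs` PARAMETERS (verbatim at
`SRec₁₂On cr Rg` ∕ `RRec₁₂On 𝔯 Rg`); every conjunct a HYPOTHESIS; NOT NE7. -/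
theorem s_N19_of_vacuumLedgerPiecesMGFReading (SRec : SpineRecordPred N) (Inputs : InputsPred N)
    (hpin : ∀ (F : T4Continuum.T4Family) (D : YMDAG.UVSplit.Datum F N) (g₀ : ℕ → ℝ) (os : List (T4Continuum.ULoop F))
      (S : SpineCarriers), SRec F D g₀ os S → letI := S.dec
      S.δ = deltaOfRecord S.l₀ S.vol S.T S.Bad (fun K t τ => S.A K t τ - S.shA K t τ) (fun K t τ => S.B K t τ - S.shB K t τ))
    (hread : ∀ (F : T4Continuum.T4Family) (D : YMDAG.UVSplit.Datum F N) (g₀ : ℕ → ℝ) (os : List (T4Continuum.ULoop F))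
      (S : SpineCarriers), SRec F D g₀ os S → Inputs F D g₀ os → letI := S.dec
      0 < S.vol ∧
      ∃ (C : Carriers) (_ : DecidableEq C.Dom) (F' : Type) (ι' X' : Type) (_ : MeasurableSpace ι')
        (L : LedgerDataSync C F' ι' S.ι) (R : Readings ι' X') (W : Set (ℕ → ℝ)) (EA : Functional C C.BgA)
        (EB : Functional C C.BgB) (κ θ₅ C₅ C₉ ω θc Cd γ C₃ θ₃ Pg : ℝ) (q : ℕ) (Λm : ℕ → ℕ → ℝ)
        (CU : (ℕ → ℝ) → ℕ → ℝ) (g : ℕ → ℕ → ℝ) (uA : ℕ → ι' → C.BgA) (uB : ℕ → ι' → C.BgB)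
        (Φ : ℕ → ℝ → S.ι → ι' → ℝ) (e ρ : ℕ → ℝ) (α β : ℕ → ℝ → S.ι → ℝ)
        (η : ℕ → ℝ) (Ω Ω' : ℕ → Type) (_ : ∀ K, MeasurableSpace (Ω K)) (_ : ∀ K, MeasurableSpace (Ω' K)) (Bo : ℝ)
        (Fo : ∀ K, Ω K → ℝ) (ν : ∀ K, S.ι → Measure (Ω K)) (Fo' : ∀ K, Ω' K → ℝ) (ν' : ∀ K, S.ι → Measure (Ω' K)),
        (TwoRunFormat L S.l₀ S.T S.Bad (fun K _ τ => S.A K 0 τ - S.shA K 0 τ) (fun K _ τ => S.B K 0 τ - S.shB K 0 τ) R EA EB g uA uB ∧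
          LedgerBooking L S.l₀ S.vol S.T S.Bad κ ∧ LedgerOtherKinds L S.l₀ S.vol S.T S.Bad R EA EB g ∧
          LedgerSize L S.l₀ S.vol S.T S.Bad R EA EB g uA uB ∧ LedgerConventions L S.vol R ω θc θ₅ θ₃) ∧
        ((∀ K t τ v, L.oA'' K t τ v = Real.exp (α K t τ)) ∧
          (∀ K t τ v, L.oB'' K t τ v = Real.exp (Φ K t τ v + e K) * Real.exp (β K t τ)) ∧
          (∀ K t τ, L.cO'' K t τ = e K + (β K t τ - α K t τ)) ∧ (∀ K t τ, L.RO'' K t τ = S.vol * ρ K) ∧ L.rO'' = ρ ∧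
          (∀ K t, |t| ≤ S.l₀ → ∀ τ ∈ S.T K \ S.Bad K t, ∀ v ∈ R.dom, |Φ K t τ v| ≤ S.vol * ρ K) ∧ Summable ρ ∧
          (∃ b₀ s : ℕ → ℝ, Summable s ∧ ∀ K t, |t| ≤ S.l₀ → ∀ τ ∈ S.T K \ S.Bad K t, |β K t τ - α K t τ - b₀ K| ≤ S.vol * s K)) ∧
        (NE3Shape R C₃ θ₃ ∧ 0 ≤ C₃ ∧ GaugeDominated R uA uB ∧
          NE5 EA EB W κ θ₅ C₅ ∧ 0 ≤ θ₅ ∧ 0 ≤ C₅ ∧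
          (NE9 EA W κ Λm ∧ T4OutputRate.FadingMemory C₉ ω Λm) ∧ 0 ≤ ω ∧
          InjectedRate Cd 0 θc (fun K j => T4CouplingMatching.disc (g K) (g (K + 1)) j) ∧ 0 ≤ Cd ∧ 0 ≤ θc ∧
          (∀ K i, i ≤ K → 0 < g K i ∧ g K i ≤ γ) ∧
          LipBackground EA W κ CU ∧ PolyLipGrowth CU g Pg q ∧ 0 ≤ Pg ∧
          (∀ K, g K ∈ W) ∧ (∀ K, (fun i => g (K + 1) (i + 1)) ∈ W)) ∧
        (MGFForm Bo S.T Fo ν (fun K t τ => S.A K t τ - S.shA K t τ) ∧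
          MGFForm Bo S.T Fo' ν' (fun K t τ => S.B K t τ - S.shB K t τ) ∧
          TiltedMeanMatching S.l₀ S.T S.Bad Fo ν Fo' ν' η ∧ Summable η)) :
    S_N19 SRec Inputs := by
  refine s_N19_of_coreEdge SRec Inputs hpin fun F D g₀ os S hS hI => ?_
  letI := S.dec
  obtain ⟨hvol, C, _, F', ι', X', _, L, R, W, EA, EB, κ, θ₅, C₅, C₉, ω, θc, Cd, γ, C₃, θ₃, Pg, q, Λm, CU, g, uA, uB, Φ, e, ρ, α, β,
    η, Ω, Ω', _, _, Bo, Fo, ν, Fo', ν',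
    ⟨hF, hB, hO, hSz, hC⟩, ⟨hoA, hoB, hcO, hRO, hrO, hΦ, hρ, hdev⟩,
    ⟨h16, hC₃, hgd, h18, hθ₅, hC₅, h22, hω, hinj, hCd, hθc, hbox, hU, hG, hPg, hgA, hgB⟩, hP, hQ, hη, hηs⟩ := hread F D g₀ os S hS hI
  exact coreEdge_of_vacuumLedgerPiecesSpecies_mgfForm hF hB hO hSz hC hoA hoB hcO hRO hrO hΦ hρ hdev h16 hC₃ hgd h18 hθ₅ hC₅ h22 hω hinj hCd
    hθc hbox hU hG hPg hgA hgB hvol hP hQ hη hηs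

end LedgerPiecesReading

end Summit.QuantumFields.YangMills.BalabanUVNodes.N19VacuumMGFRoad

end
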